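import Mathlib.LinearAlgebra.Matrix.Permanent
import Mathlib.LinearAlgebra.Matrix.Notation
import Mathlib.GroupTheory.Perm.Fin
import Mathlib.Data.ZMod.Basic
import Literature.LinearAlgebra.Matrix.PermanentLaplace
import Literature.LinearAlgebra.Matrix.PermanentEqualRows
import Literature.LinearAlgebra.Matrix.BerkowitzAlgorithm
import Literature.LinearAlgebra.Matrix.PermanentModTwoPowAlgorithm
import HarnessLib

/-!
# The permanent modulo `2^k` in polynomial time, II: one elimination step of Valiant's algorithm

L. G. Valiant, *The complexity of computing the permanent*, TCS 8 (1979), Thm. 3. Correctness of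
the list program `PermMod2.pm` (`PermanentModTwoPowAlgorithm.lean`), first half: the bookkeeping
between list surgery and `Matrix` re-indexing, and the congruence of ONE elimination step. The loop,
the stages and the main theorem `pm_rows` are in `PermanentModTwoPowCorrect.lean`.

* §A–§B bookkeeping between list surgery (`eraseIdx`, `zipWith`, `tail`, `++`) and `Matrix`
  re-indexing (`Fin.succAbove`, `Fin.cycleRange`, `updateRow`, `submatrix`): `matOf`, `WF`,
  `matOf_rows`, `matOf_colMinor2`, `matOf_cons_eraseIdx`, `matOf_replace_row`, `matOf_minor0`, …;
* §C entrywise congruent matrices have congruent permanents (`permanent_mod_congr`); doubling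
  halves the precision (`two_mul_mod_two_pow_succ`);
* §D the two identities of the engine — row additivity (`permanent_updateRow_add_mul`, via the
  Laplace expansion of `PermanentLaplace.lean`) and the two-equal-rows expansion
  (`permanent_eq_two_mul_pairSum` = `PermanentEqualRows.permanent_eq_two_mul_sum_of_row_eq`);
* §E **`perm_elim_step`**: replacing the row `r` after `done` by `r + d·q mod 2^(K+1)` (`q` the
  pivot row in front) changes the permanent by `2·d·pairSum q (prev ∘ minors)` modulo `2^(K+1)`,
  provided `prev` is the permanent modulo `2^K` on the `n × n` minors.

## References

* [Valiant1979] L. G. Valiant, *The complexity of computing the permanent*, Theoret. Comput. Sci.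
  8 (1979) 189–201, Thm. 3 and its proof (pp. 198–199).
-/

namespace Literature.LinearAlgebra.Matrix

namespace PermMod2

open Finset

/-! ### §A List bookkeeping -/

/-- Indexing an erased list: position `j` of `l.eraseIdx b` is position `b.succAbove j` of `l`. [folklore] -/
theorem getD_eraseIdx_succAbove {α : Type} {n : ℕ} (l : List α) (b : Fin (n + 1)) (j : Fin n) (d : α) :
    (l.eraseIdx b).getD j d = l.getD (b.succAbove j) d := by
  rw [List.getD_eq_getElem?_getD, List.getD_eq_getElem?_getD, List.getElem?_eraseIdx]
  by_cases h : (j : ℕ) < b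
  · rw [if_pos h, Fin.succAbove_of_castSucc_lt b j h]; rfl
  · rw [if_neg h, Fin.succAbove_of_le_castSucc b j (not_lt.1 h)]; rfl

/-- Length of an erased list of known length. [folklore] -/
theorem length_eraseIdx_of_lt {α : Type} {l : List α} {b n : ℕ} (hl : l.length = n + 1) (hb : b < n + 1) :
    (l.eraseIdx b).length = n := by
  rw [List.length_eraseIdx, hl, if_pos hb]; rfl

/-- Indexing a `zipWith` of two lists inside both ranges. [folklore] -/
theorem getD_zipWith_of_lt {α β γ : Type} (f : α → β → γ) (l₁ : List α) (l₂ : List β) {j : ℕ}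
    (h₁ : j < l₁.length) (h₂ : j < l₂.length) (d : γ) (d₁ : α) (d₂ : β) :
    (List.zipWith f l₁ l₂).getD j d = f (l₁.getD j d₁) (l₂.getD j d₂) := by
  rw [List.getD_eq_getElem?_getD, List.getElem?_zipWith, List.getElem?_eq_getElem h₁,
    List.getElem?_eq_getElem h₂, List.getD_eq_getElem?_getD, List.getElem?_eq_getElem h₁,
    List.getD_eq_getElem?_getD, List.getElem?_eq_getElem h₂]
  rfl

/-- Indexing the tail. [folklore] -/
theorem getD_tail {α : Type} (l : List α) (j : ℕ) (d : α) : l.tail.getD j d = l.getD (j + 1) d := by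
  cases l <;> simp

/-- Indexing `done ++ rest` is indexing `q :: done ++ r :: rest` past `q` and around `r`:
position `j` of the former is position `(t.succAbove j) + 1` of the latter, `t = |done|`. [folklore] -/
theorem getD_append_skip {α : Type} {n : ℕ} (q r : α) (done rest : List α) (t : Fin (n + 1))
    (ht : done.length = t) (j : Fin n) (d : α) :
    (done ++ rest).getD j d = (q :: (done ++ r :: rest)).getD ((t.succAbove j : ℕ) + 1) d := by
  rw [List.getD_cons_succ]
  simp only [List.getD_eq_getElem?_getD, List.getElem?_append]
  by_cases h : (j : ℕ) < t
  · rw [Fin.succAbove_of_castSucc_lt t j h, Fin.val_castSucc, if_pos (by omega), if_pos (by omega)]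
  · rw [Fin.succAbove_of_le_castSucc t j (not_lt.1 h), Fin.val_succ, if_neg (by omega), if_neg (by omega),
      show (j : ℕ) + 1 - done.length = (j - done.length) + 1 by omega, List.getElem?_cons_succ]

/-- The first odd entry, when found, is in range and odd. [folklore] -/
theorem firstOdd_some {l : List ℕ} {p : ℕ} (h : firstOdd l = some p) : p < l.length ∧ l.getD p 0 % 2 = 1 := by
  unfold firstOdd at h
  obtain ⟨hp, hodd, -⟩ := List.findIdx?_eq_some_iff_getElem.1 h
  refine ⟨hp, ?_⟩
  rw [List.getD_eq_getElem?_getD, List.getElem?_eq_getElem hp]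
  simpa using hodd

/-- When no odd entry is found, every entry is even. [folklore] -/
theorem firstOdd_none {l : List ℕ} (h : firstOdd l = none) (j : ℕ) : l.getD j 0 % 2 = 0 := by
  unfold firstOdd at h
  rw [List.findIdx?_eq_none_iff] at h
  rw [List.getD_eq_getElem?_getD]
  cases hj : l[j]? with
  | none => simp
  | some x =>
    have hx : x ∈ l := List.mem_of_getElem? hj
    have := h x hx
    simp only [beq_eq_false_iff_ne, ne_eq, Option.getD_some] at this ⊢
    omega

/-! ### §B List matrices and their `Matrix` semantics -/

/-- The `r × c`-reading of a list of rows: entry `(i, j)` is `L[i][j]`, `0` past the ends. [folklore] -/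
def matOf (r c : ℕ) (L : List (List ℕ)) : _root_.Matrix (Fin r) (Fin c) ℕ :=
  _root_.Matrix.of fun i j => (L.getD i []).getD j 0

/-- Well-formed `r × c` list matrices: `r` rows, each of length `c`. [folklore] -/
def WF (r c : ℕ) (L : List (List ℕ)) : Prop :=
  L.length = r ∧ ∀ row ∈ L, row.length = c

/-- Entry of `matOf`. [folklore] -/
@[simp] theorem matOf_apply (r c : ℕ) (L : List (List ℕ)) (i : Fin r) (j : Fin c) :
    matOf r c L i j = (L.getD i []).getD j 0 := rfl

/-- Reading back the row list of a matrix. [folklore] -/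
theorem matOf_rows {r c : ℕ} (M : _root_.Matrix (Fin r) (Fin c) ℕ) : matOf r c (Berkowitz.rows M) = M := by
  ext i j
  rw [matOf_apply, Berkowitz.rows, Berkowitz.getD_ofFn, dif_pos i.isLt, Berkowitz.getD_ofFn, dif_pos j.isLt]

/-- The row list of a matrix is well formed. [folklore] -/
theorem wf_rows {r c : ℕ} (M : _root_.Matrix (Fin r) (Fin c) ℕ) : WF r c (Berkowitz.rows M) := by
  refine ⟨by simp [Berkowitz.rows], fun row hrow => ?_⟩
  simp only [Berkowitz.rows, List.mem_ofFn] at hrow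
  obtain ⟨i, rfl⟩ := hrow
  simp

/-- Indexing a mapped list of rows (for a map fixing the empty row). [folklore] -/
theorem getD_map_rows (f : List ℕ → List ℕ) (hf : f [] = []) (l : List (List ℕ)) (i : ℕ) :
    (l.map f).getD i [] = f (l.getD i []) := by
  rw [List.getD_eq_getElem?_getD, List.getD_eq_getElem?_getD, List.getElem?_map]
  cases l[i]? with
  | none => exact hf.symm
  | some _ => rfl

/-- **Double column deletion read as a submatrix** (rows: all but `q` and `r` of
`q :: done ++ r :: rest`, i.e. `Fin.succ ∘ t.succAbove` with `t = |done|`; columns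
`b.succAbove ∘ b'.succAbove`). [folklore] -/
theorem matOf_colMinor2 {n m : ℕ} (q r : List ℕ) (done rest : List (List ℕ)) (t : Fin (m + 1))
    (ht : done.length = t) (b : Fin (n + 2)) (b' : Fin (n + 1)) :
    matOf m n (colMinor2 b b' (done ++ rest)) =
      (matOf (m + 2) (n + 2) (q :: (done ++ r :: rest))).submatrix (Fin.succ ∘ t.succAbove)
        (b.succAbove ∘ b'.succAbove) := by
  ext i j
  simp only [matOf_apply, _root_.Matrix.submatrix_apply, Function.comp_apply, colMinor2]
  rw [getD_map_rows _ rfl, getD_eraseIdx_succAbove, getD_eraseIdx_succAbove, Fin.val_succ,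
    getD_append_skip q r done rest t ht i]

/-- **Moving row `p` to the front read as a row permutation** (`Fin.cycleRange`). [folklore] -/
theorem matOf_cons_eraseIdx {n c : ℕ} (B : List (List ℕ)) (p : Fin (n + 1)) :
    matOf (n + 1) c (B.getD p [] :: B.eraseIdx p) =
      (matOf (n + 1) c B).submatrix (⇑p.cycleRange.symm) id := by
  ext i j
  simp only [matOf_apply, _root_.Matrix.submatrix_apply, id]
  refine Fin.cases ?_ (fun i' => ?_) i
  · rw [Fin.cycleRange_symm_zero]; rfl
  · rw [Fin.cycleRange_symm_succ, Fin.val_succ, List.getD_cons_succ, getD_eraseIdx_succAbove]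

/-- Indexing `q :: done ++ x :: rest` at the position of `x`. [folklore] -/
theorem getD_cons_append_cons_self {α : Type} (q x : α) (done rest : List α) (d : α) :
    (q :: (done ++ x :: rest)).getD (done.length + 1) d = x := by
  rw [List.getD_cons_succ, List.getD_eq_getElem?_getD, List.getElem?_append_right (le_refl _)]
  simp

/-- Indexing `q :: done ++ x :: rest` elsewhere does not see `x`. [folklore] -/
theorem getD_cons_append_cons_ne {α : Type} (q x y : α) (done rest : List α) {i : ℕ}
    (hi : i ≠ done.length + 1) (d : α) :
    (q :: (done ++ x :: rest)).getD i d = (q :: (done ++ y :: rest)).getD i d := by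
  cases i with
  | zero => rfl
  | succ i =>
    rw [List.getD_cons_succ, List.getD_cons_succ]
    simp only [List.getD_eq_getElem?_getD, List.getElem?_append]
    split
    · rfl
    · rw [show i - done.length = (i - done.length - 1) + 1 by omega, List.getElem?_cons_succ,
        List.getElem?_cons_succ]

/-- **Replacing the row after `done` read as `updateRow`.** [folklore] -/
theorem matOf_replace_row {m c : ℕ} (q r r' : List ℕ) (done rest : List (List ℕ)) (t : Fin (m + 1))
    (ht : done.length = t) :
    matOf (m + 2) c (q :: (done ++ r' :: rest)) =
      (matOf (m + 2) c (q :: (done ++ r :: rest))).updateRow t.succ (fun j => r'.getD j 0) := by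
  ext i j
  simp only [matOf_apply]
  by_cases hi : i = t.succ
  · subst hi
    rw [_root_.Matrix.updateRow_self, Fin.val_succ, ← ht, getD_cons_append_cons_self]
  · rw [_root_.Matrix.updateRow_ne hi, matOf_apply]
    have : (i : ℕ) ≠ done.length + 1 := fun h => hi (Fin.ext (by rw [h, Fin.val_succ, ht]))
    rw [getD_cons_append_cons_ne q r' r done rest this]

/-- **Deleting row `a` and column `0` read as a submatrix.** [folklore] -/
theorem matOf_minor0 {n c : ℕ} (B : List (List ℕ)) (a : Fin (n + 1)) :
    matOf n c (minor0 a B) = (matOf (n + 1) (c + 1) B).submatrix a.succAbove Fin.succ := by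
  ext i j
  simp only [matOf_apply, _root_.Matrix.submatrix_apply, minor0]
  rw [getD_map_rows _ rfl, getD_tail, Fin.val_succ, getD_eraseIdx_succAbove]

/-- **Dropping the first row and the first column read as a submatrix.** [folklore] -/
theorem matOf_map_tail {n c : ℕ} (q : List ℕ) (done : List (List ℕ)) :
    matOf n c (done.map List.tail) = (matOf (n + 1) (c + 1) (q :: done)).submatrix Fin.succ Fin.succ := by
  ext i j
  simp only [matOf_apply, _root_.Matrix.submatrix_apply]
  rw [getD_map_rows _ rfl, getD_tail, Fin.val_succ, Fin.val_succ, List.getD_cons_succ]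

/-- Entries of `addRow`. [folklore] -/
theorem getD_addRow {N d : ℕ} {r q : List ℕ} {j : ℕ} (hr : j < r.length) (hq : j < q.length) :
    (addRow N d r q).getD j 0 = (r.getD j 0 + d * q.getD j 0) % N :=
  getD_zipWith_of_lt _ r q hr hq 0 0 0

/-- Length of `addRow` on rows of equal length. [folklore] -/
theorem length_addRow {N d : ℕ} {r q : List ℕ} {c : ℕ} (hr : r.length = c) (hq : q.length = c) :
    (addRow N d r q).length = c := by
  rw [addRow, List.length_zipWith, hr, hq, min_self]

/-- The list of column-`0` entries, indexed. [folklore] -/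
theorem getD_heads (B : List (List ℕ)) (a : ℕ) :
    (B.map fun r => r.headD 0).getD a 0 = (B.getD a []).headD 0 := by
  rw [List.getD_eq_getElem?_getD, List.getElem?_map, List.getD_eq_getElem?_getD (l := B)]
  cases B[a]? <;> rfl

/-! ### §C Permanents modulo `N` -/

/-- Ring homomorphisms commute with the permanent. [folklore] -/
theorem ringHom_map_permanent {R S : Type} [CommSemiring R] [CommSemiring S] (f : R →+* S) {ι : Type}
    [Fintype ι] [DecidableEq ι] (M : _root_.Matrix ι ι R) : f M.permanent = (M.map f).permanent := by
  unfold _root_.Matrix.permanent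
  simp [map_sum, map_prod]

/-- **Entrywise congruent matrices have congruent permanents.** [folklore] -/
theorem permanent_mod_congr {ι : Type} [Fintype ι] [DecidableEq ι] (N : ℕ) {M M' : _root_.Matrix ι ι ℕ}
    (h : ∀ i j, M i j % N = M' i j % N) : M.permanent % N = M'.permanent % N := by
  rw [← ZMod.natCast_eq_natCast_iff', ← Nat.coe_castRingHom, ringHom_map_permanent,
    ringHom_map_permanent]
  congr 1
  ext i j
  simp only [_root_.Matrix.map_apply, Nat.coe_castRingHom]
  exact (ZMod.natCast_eq_natCast_iff' _ _ _).2 (h i j)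

/-- Doubling halves the required precision: `x ≡ y (mod 2^K) → 2x ≡ 2y (mod 2^(K+1))`. [folklore] -/
theorem two_mul_mod_two_pow_succ {K x y : ℕ} (h : x % 2 ^ K = y % 2 ^ K) :
    2 * x % 2 ^ (K + 1) = 2 * y % 2 ^ (K + 1) := by
  rw [Nat.pow_succ', Nat.mul_mod_mul_left, Nat.mul_mod_mul_left, h]

/-- The correction congruence: `S ≡ X (mod 2^K) → d·(2·S) ≡ 2·d·X (mod 2^(K+1))`. [folklore] -/
theorem two_mul_corr_congr {K d S X : ℕ} (h : S % 2 ^ K = X % 2 ^ K) :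
    d * (2 * S) % 2 ^ (K + 1) = 2 * d * X % 2 ^ (K + 1) := by
  rw [show d * (2 * S) = 2 * (d * S) by ring, show 2 * d * X = 2 * (d * X) by ring]
  apply two_mul_mod_two_pow_succ
  rw [Nat.mul_mod, h, ← Nat.mul_mod]

/-! ### §D The two permanent identities (Valiant's engine) -/

/-- **Row additivity with a multiple of another row**: replacing row `i` by `row i + d · row p`
adds `d · perm(A[i ← row p])`. [cite: Valiant1979, Thm. 3 (proof)] -/
theorem permanent_updateRow_add_mul {n : ℕ} (A : _root_.Matrix (Fin n) (Fin n) ℕ) (i p : Fin n) (d : ℕ) :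
    (A.updateRow i (fun j => A i j + d * A p j)).permanent =
      A.permanent + d * (A.updateRow i (A p)).permanent := by
  cases n with
  | zero => exact i.elim0
  | succ n =>
    -- Laplace along row `i`: the permanent of `A[i ← v]` is linear in `v`
    have hlin : ∀ v : Fin (n + 1) → ℕ, (A.updateRow i v).permanent =
        ∑ j, v j * (A.submatrix i.succAbove j.succAbove).permanent := fun v => by
      rw [_root_.Matrix.permanent_eq_sum_row _ i]
      refine Finset.sum_congr rfl fun j _ => ?_
      rw [_root_.Matrix.updateRow_self, _root_.Matrix.submatrix_updateRow_succAbove]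
    have h0 : A.permanent = (A.updateRow i (A i)).permanent := by rw [_root_.Matrix.updateRow_eq_self]
    rw [h0, hlin, hlin, hlin, Finset.mul_sum, ← Finset.sum_add_distrib]
    refine Finset.sum_congr rfl fun j _ => ?_
    ring

/-- **Two equal rows** (`a` and `a.succAbove p`): the permanent is twice the sum over column pairs
`b < b.succAbove b'` (`b ≤ b'`) of `B a b · B a (b.succAbove b') · perm(minor)`. [cite: Valiant1979, Thm. 3 (proof)] -/
theorem permanent_eq_two_mul_pairSum {n : ℕ} (B : _root_.Matrix (Fin (n + 2)) (Fin (n + 2)) ℕ)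
    (a : Fin (n + 2)) (p : Fin (n + 1)) (h : B a = B (a.succAbove p)) :
    B.permanent = 2 * ∑ b : Fin (n + 2), ∑ b' : Fin (n + 1),
      if (b : ℕ) ≤ (b' : ℕ) then
        B a b * B a (b.succAbove b') *
          (B.submatrix (a.succAbove ∘ p.succAbove) (b.succAbove ∘ b'.succAbove)).permanent
      else 0 :=
  permanent_eq_two_mul_sum_of_row_eq B a p h

/-! ### §E One elimination step modulo `2^(K+1)` -/

/-- List sums over `List.range` are `Finset.range` sums. [folklore] -/
theorem sum_map_range (f : ℕ → ℕ) (n : ℕ) : ((List.range n).map f).sum = ∑ i ∈ Finset.range n, f i := by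
  induction n with
  | zero => simp
  | succ n ih => rw [List.range_succ, List.map_append, List.sum_append, ih, Finset.sum_range_succ]; simp

/-- `pairSum` as a double `Finset.range` sum. [folklore] -/
theorem pairSum_eq (q : List ℕ) (f : ℕ → ℕ → ℕ) :
    pairSum q f = ∑ b ∈ Finset.range q.length, ∑ b' ∈ Finset.range (q.length - 1),
      if b ≤ b' then q.getD b 0 * q.getD (b' + 1) 0 * f b b' else 0 := by
  rw [pairSum, sum_map_range]
  exact Finset.sum_congr rfl fun b _ => sum_map_range _ _

/-- Rows of a well-formed matrix other than two of them, with two columns deleted, are well formed. [folklore] -/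
theorem wf_colMinor2 {n : ℕ} {q r : List ℕ} {done rest : List (List ℕ)}
    (hwf : WF (n + 2) (n + 2) (q :: (done ++ r :: rest))) (b : Fin (n + 2)) (b' : Fin (n + 1)) :
    WF n n (colMinor2 b b' (done ++ rest)) := by
  obtain ⟨hlen, hrows⟩ := hwf
  refine ⟨?_, fun row hrow => ?_⟩
  · simp only [colMinor2, List.length_map, List.length_append]
    simp only [List.length_cons, List.length_append] at hlen
    omega
  · simp only [colMinor2, List.mem_map, List.mem_append] at hrow
    obtain ⟨row₀, hmem, rfl⟩ := hrow
    have h₀ : row₀.length = n + 2 := hrows row₀ (by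
      rcases hmem with h | h
      · exact List.mem_cons_of_mem _ (List.mem_append_left _ h)
      · exact List.mem_cons_of_mem _ (List.mem_append_right _ (List.mem_cons_of_mem _ h)))
    have h₁ : (row₀.eraseIdx b).length = n + 1 := length_eraseIdx_of_lt h₀ b.isLt
    exact length_eraseIdx_of_lt h₁ b'.isLt

/-- **One elimination step, modulo `2^(K+1)`.** Replacing the row `r` after `done` by
`r + d·q mod 2^(K+1)` (`q` the pivot row in front) changes the permanent by
`2 · d · pairSum q (prev ∘ minors)` modulo `2^(K+1)`, provided `prev` computes permanents modulo
`2^K` on well-formed `n × n` inputs (the minors avoid the rows `q` and `r`). [cite: Valiant1979, Thm. 3 (proof)] -/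
theorem perm_elim_step {K n : ℕ} {prev : List (List ℕ) → ℕ}
    (hprev : ∀ L, WF n n L → prev L % 2 ^ K = (matOf n n L).permanent % 2 ^ K)
    (q r : List ℕ) (done rest : List (List ℕ)) (hwf : WF (n + 2) (n + 2) (q :: (done ++ r :: rest)))
    (d : ℕ) :
    (matOf (n + 2) (n + 2) (q :: (done ++ addRow (2 ^ (K + 1)) d r q :: rest))).permanent % 2 ^ (K + 1) =
      ((matOf (n + 2) (n + 2) (q :: (done ++ r :: rest))).permanent +
        2 * d * pairSum q (fun b b' => prev (colMinor2 b b' (done ++ rest)))) % 2 ^ (K + 1) := by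
  obtain ⟨hlen, hrows⟩ := hwf
  have hq : q.length = n + 2 := hrows q (by simp)
  have hr : r.length = n + 2 := hrows r (by simp)
  have htle : done.length < n + 1 := by
    simp only [List.length_cons, List.length_append] at hlen; omega
  set t : Fin (n + 1) := ⟨done.length, htle⟩ with ht
  have htv : (t : ℕ) = done.length := rfl
  set M := matOf (n + 2) (n + 2) (q :: (done ++ r :: rest)) with hM
  set N := 2 ^ (K + 1) with hN
  -- Step 1–2: the new matrix is `M` with row `t.succ` replaced, entrywise ≡ `row + d·q`
  have hnew : (matOf (n + 2) (n + 2) (q :: (done ++ addRow N d r q :: rest))).permanent % N =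
      (M.updateRow t.succ (fun j => M t.succ j + d * M 0 j)).permanent % N := by
    rw [matOf_replace_row q r (addRow N d r q) done rest t rfl]
    refine permanent_mod_congr N fun i j => ?_
    by_cases hi : i = t.succ
    · subst hi
      rw [_root_.Matrix.updateRow_self, _root_.Matrix.updateRow_self,
        getD_addRow (by rw [hr]; exact j.isLt) (by rw [hq]; exact j.isLt), Nat.mod_mod,
        hM, matOf_apply, matOf_apply, Fin.val_succ, htv, getD_cons_append_cons_self, Fin.val_zero,
        List.getD_cons_zero]
    · rw [_root_.Matrix.updateRow_ne hi, _root_.Matrix.updateRow_ne hi]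
  -- Step 3: row additivity
  have hadd := permanent_updateRow_add_mul M t.succ 0 d
  -- Step 4: two equal rows
  set B := M.updateRow t.succ (M 0) with hB
  have hBa : B t.succ = B (t.succ.succAbove 0) := by
    rw [Fin.succ_succAbove_zero, hB, _root_.Matrix.updateRow_self,
      _root_.Matrix.updateRow_ne (M := M) (Fin.succ_ne_zero t).symm]
  have htwo := permanent_eq_two_mul_pairSum B t.succ 0 hBa
  -- the minors of `B` avoiding rows `t.succ`, `0` are the list minors
  have hminor : ∀ (b : Fin (n + 2)) (b' : Fin (n + 1)),
      B.submatrix (t.succ.succAbove ∘ (0 : Fin (n + 1)).succAbove) (b.succAbove ∘ b'.succAbove) =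
        matOf n n (colMinor2 b b' (done ++ rest)) := by
    intro b b'
    rw [matOf_colMinor2 q r done rest t rfl b b', ← hM]
    ext i j
    simp only [_root_.Matrix.submatrix_apply, Function.comp_apply, Fin.succAbove_zero,
      Fin.succ_succAbove_succ, hB]
    rw [_root_.Matrix.updateRow_ne (M := M) (fun h => Fin.succAbove_ne t i (Fin.succ_injective _ h))]
  have hBrow : ∀ b : Fin (n + 2), B t.succ b = q.getD b 0 := fun b => by
    rw [hB, _root_.Matrix.updateRow_self, hM, matOf_apply]; rfl
  -- Step 5: the exact correction sum versus `pairSum … prev …` modulo `2^K`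
  set P : ℕ → ℕ → ℕ := fun b b' => (matOf n n (colMinor2 b b' (done ++ rest))).permanent with hP
  have hsumFin : (∑ b : Fin (n + 2), ∑ b' : Fin (n + 1),
      if (b : ℕ) ≤ (b' : ℕ) then B t.succ b * B t.succ (b.succAbove b') *
        (B.submatrix (t.succ.succAbove ∘ (0 : Fin (n + 1)).succAbove) (b.succAbove ∘ b'.succAbove)).permanent
      else 0) =
      ∑ b ∈ Finset.range (n + 2), ∑ b' ∈ Finset.range (n + 1),
        if b ≤ b' then q.getD b 0 * q.getD (b' + 1) 0 * P b b' else 0 := by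
    rw [← Fin.sum_univ_eq_sum_range (fun b => ∑ b' ∈ Finset.range (n + 1),
        if b ≤ b' then q.getD b 0 * q.getD (b' + 1) 0 * P b b' else 0) (n + 2)]
    refine Finset.sum_congr rfl fun b _ => ?_
    rw [← Fin.sum_univ_eq_sum_range (fun b' => if (b : ℕ) ≤ b' then q.getD b 0 * q.getD (b' + 1) 0 * P b b' else 0) (n + 1)]
    refine Finset.sum_congr rfl fun b' _ => ?_
    by_cases hbb : (b : ℕ) ≤ (b' : ℕ)
    · rw [if_pos hbb, if_pos hbb, hminor, hBrow, hBrow, Fin.succAbove_of_le_castSucc b b' hbb, Fin.val_succ]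
    · rw [if_neg hbb, if_neg hbb]
  have hsumMod : (∑ b ∈ Finset.range (n + 2), ∑ b' ∈ Finset.range (n + 1),
        if b ≤ b' then q.getD b 0 * q.getD (b' + 1) 0 * P b b' else 0) % 2 ^ K =
      pairSum q (fun b b' => prev (colMinor2 b b' (done ++ rest))) % 2 ^ K := by
    rw [pairSum_eq, hq, show n + 2 - 1 = n + 1 from rfl, Finset.sum_nat_mod]
    conv_rhs => rw [Finset.sum_nat_mod]
    congr 1
    refine Finset.sum_congr rfl fun b hb => ?_
    rw [Finset.sum_nat_mod]
    conv_rhs => rw [Finset.sum_nat_mod]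
    congr 1
    refine Finset.sum_congr rfl fun b' hb' => ?_
    by_cases hbb : b ≤ b'
    · rw [if_pos hbb, if_pos hbb, Nat.mul_mod, hP]
      have hwf' : WF n n (colMinor2 b b' (done ++ rest)) := by
        have := wf_colMinor2 (q := q) (r := r) ⟨hlen, hrows⟩ ⟨b, Finset.mem_range.1 hb⟩ ⟨b', Finset.mem_range.1 hb'⟩
        exact this
      rw [← hprev _ hwf', ← Nat.mul_mod]
    · rw [if_neg hbb, if_neg hbb]
  -- Step 6: assemble
  rw [hnew, hadd, htwo, hsumFin, Nat.add_mod, hN, two_mul_corr_congr hsumMod, ← Nat.add_mod]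

end PermMod2

end Literature.LinearAlgebra.Matrix
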